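import Summits.QuantumFields.BalabanUV.T4Continuum.Support.VariationalColourRegularity
import Summits.QuantumFields.BalabanUV.T4Continuum.Support.VariationalColourOneStepPhys

/-!
# T⁴ programme, spine node NE2 (U1a), lane P2 — SUPPLIER ITEM «V-COL-CLOSED», file C: LEAF REG⁺-COLOUR IN THE COLOUR PAIR'S CURRENCY —
# the `hREG` binder of `VariationalColourScalarPair.colour_pair_bracket` (p215316) for leaf V-COL-ONE's regularity functional
# `VariationalColourOneStepPhys.rhov` (p215426), `C_R = 2Λ + 2d·(a n²) + d²·(a n²)²·C_P`
# (the colour re-run of leaf-09-g3's `VariationalCovariantRegularityScalar` ∕ `…Rho`; leaf REG⁺-colour, part 3∕3)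

NE2 formalisation swarm `b2b-balaban-t4-ne2-formalise-*`, leaf prover 02 (gen 5); register P2-sup, item «V-COL-CLOSED» (INTENT CLAIMS.log
l.14931).  WIRING ONLY, over: file B `VariationalColourRegularity.nsqv_negLapv_le_of_isMin` (Euler–Lagrange ∕ UB⁺-duality, lattice units),
leaf-09-g4's colour Bochner estimate `VariationalColourBochner.hessian_le` (p215065; UNITARY bond operators, plaquette defect `a` in operator
norm) and the colour letters `Scv ∕ qWv ∕ Qkv` (p215316), `rhov` (p215426) BY NAME:
 * `rhoLapv f := n⁴∕n^d·Σ_x‖(D†D f)(x)‖²` — **`rhoLapv_le_of_isMin`**: at a constrained minimiser of `Scv` on the fibre `{Qkv T g = μ}`,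
   `rhoLapv f ≤ Λ·Scv f` for every UB⁺ constant `Λ` of the binder `hUBc : ∀ μ, ∃ f, Qkv T f = μ ∧ Scv f ≤ Λ·nsqv μ` (supplied by leaf-03-g4's
   `VariationalColourUpperBound.exists_ubv_phys`, NOT here);
 * **`rhov_le`** (every `f`, Bochner in physical units): `rhov f ≤ 2·rhoLapv f + 2d·(a n²)·Scv f + d²·(a n²)²·qWv f`
   (`hessv = Σ_{μ,ν} nsqv (D_μ D_ν ·)` by `rfl`);
 * **`hREG_rhov`**: with the P⁺ binder `hPc : ∀ f, qWv f ≤ C_P·(Scv f + nsqv (Qkv T f))` (supplied by leaf-02-g4's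
   `VariationalColourPoincarePhys.qWv_le_coarse_local`, `C_P = 136`, NOT here):
   `∀ μ f, Qkv T f = μ → (∀ g, Qkv T g = μ → Scv f ≤ Scv g) → rhov f ≤ (2Λ + 2d·(a n²) + d²·(a n²)²·C_P)·(Scv f + nsqv μ)` — LITERALLY the
   `hREG` binder of `colour_pair_bracket` ∕ `VariationalCovariantAssemblySqrt.pair_bracket_sqrt` at `ρ := rhov n M Rc` (for the unit-smooth
   class `a n² ≍ α`: k-UNIFORM).  No NE3, no propagator localisation.

HONEST FRAMING (T4-DAG p. 1).  Model level: UNITARY bond operators `Rc` (plaquette defect `a`, DATA) and UNITARY site operators `T` (DATA);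
0-form sector; ONE level.  [folklore] wiring; nothing printed is a hypothesis; no `def … : Prop`; no `sorry`; axioms standard.  NE2 NOT proved;
spine PROVED 0∕9; rung (B)+1 finite T⁴ — NOT infinite volume, NOT a mass gap, NOT Clay.  HONEST DEPENDENCY (cell, verbatim): continuum YM on
T⁴ ⇐ BetaPertH ∧ nine spine estimates (0/9 proved); BetaPertH ⇐ (D1) ∧ (D4) ∧ CAP+tail; G-an2-4 gates asym, D1 and NE2/3/4.
-/

noncomputable section

namespace Summit.QuantumFields.BalabanUV.T4Continuum.VariationalColourRegularityRho

open Finset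
open Literature.MathematicalPhysics.QuantumFieldTheory.Balaban1983to89
open Literature.MathematicalPhysics.QuantumFieldTheory.Balaban1983to89.B5Prop11Plancherel (Tor fine unitVec)
open Summit.QuantumFields.BalabanUV.T4Continuum.VariationalColourFederbush (cDv dirUv Qcv dirUv_nonneg)
open Summit.QuantumFields.BalabanUV.T4Continuum.VariationalColourBochner (Dirv negLapv hessian_le sum_nsqv_Dirv_eq)
open Summit.QuantumFields.BalabanUV.T4Continuum.VariationalColourUpperBound (nsqv nsqv_nonneg)
open Summit.QuantumFields.BalabanUV.T4Continuum.VariationalColourInterpolant (hessv)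
open Summit.QuantumFields.BalabanUV.T4Continuum.VariationalColourScalarPair (Scv qWv Qkv Scv_nonneg qWv_nonneg)
open Summit.QuantumFields.BalabanUV.T4Continuum.VariationalColourOneStepPhys (rhov)
open Summit.QuantumFields.BalabanUV.T4Continuum.VariationalColourRegularity (nsqv_negLapv_le_of_isMin)

variable {d : ℕ} {E : Type*} [NormedAddCommGroup E] [InnerProductSpace ℂ E] [CompleteSpace E]
variable (n : ℕ) [NeZero n] (M : Fin d → ℕ) [hM : ∀ μ, NeZero (M μ)]

/-! ## §1 The Laplacian regularity functional in physical units; dictionary to the colour letters -/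

/-- `ρ_Lap f = n⁴∕n^d·Σ_x ‖(D†D f)(x)‖²` — the `L²`-norm² of the colour covariant Laplacian in physical units. [folklore] -/
def rhoLapv (Rc : Tor (fine n M) → Fin d → (E →L[ℂ] E)) (f : Tor (fine n M) → E) : ℝ :=
  (n : ℝ) ^ 4 / (n : ℝ) ^ d * VariationalColourBochner.nsqv (fine n M) (negLapv (fine n M) Rc f)

/-- `ρ_Lap ≥ 0`. [folklore] -/
theorem rhoLapv_nonneg (Rc : Tor (fine n M) → Fin d → (E →L[ℂ] E)) (f : Tor (fine n M) → E) : 0 ≤ rhoLapv n M Rc f :=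
  mul_nonneg (by positivity) (VariationalColourBochner.nsqv_nonneg _ _)

omit [CompleteSpace E] in
/-- `Scv` is `n²∕n^d·Σ_μ dirUv`. [folklore] -/
theorem Scv_eq (Rc : Tor (fine n M) → Fin d → (E →L[ℂ] E)) (f : Tor (fine n M) → E) :
    Scv n M Rc f = (n : ℝ) ^ 2 / (n : ℝ) ^ d * ∑ μ, dirUv (fine n M) Rc f μ := rfl

omit [NeZero n] hM [CompleteSpace E] in
/-- `Qkv T f` is `Qcv T f`. [folklore] -/
theorem Qkv_eq_Qcv (T : Tor (fine n M) → (E →L[ℂ] E)) (f : Tor (fine n M) → E) : Qkv n M T f = Qcv n M T f := rfl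

omit [InnerProductSpace ℂ E] [CompleteSpace E] in
/-- the two `ℓ²` sizes of the tree agree: leaf-03-g4's `nsqv φ` is `Σ_z ‖φ z‖²`. [folklore] -/
theorem nsqv_eq_sum (φ : Tor M → E) : nsqv φ = ∑ z, ‖φ z‖ ^ 2 := rfl

omit [CompleteSpace E] in
/-- leaf V-COL-ONE's `hessv` IS `Σ_{μ,ν} nsqv (D_μ D_ν f)` of the colour Bochner file (definitionally). [folklore] -/
theorem hessv_eq_sum_nsqv (Rc : Tor (fine n M) → Fin d → (E →L[ℂ] E)) (f : Tor (fine n M) → E) :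
    hessv (fine n M) Rc f = ∑ μ, ∑ ν, VariationalColourBochner.nsqv (fine n M) (Dirv (fine n M) Rc μ (Dirv (fine n M) Rc ν f)) := rfl

/-! ## §2 `ρ_Lap ≤ Λ·Scv` at the constrained minimiser -/

omit [CompleteSpace E] in
/-- the UB⁺ binder in `Scv`-units gives the lattice-unit binder with `Λ_lat = Λ·n^d∕n²`. [folklore] -/
theorem hUB_lat {Rc : Tor (fine n M) → Fin d → (E →L[ℂ] E)} {T : Tor (fine n M) → (E →L[ℂ] E)} {Λ : ℝ}
    (hUBc : ∀ μ : Tor M → E, ∃ f, Qkv n M T f = μ ∧ Scv n M Rc f ≤ Λ * nsqv μ) (ν : Tor M → E) :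
    ∃ lam : Tor (fine n M) → E, Qcv n M T lam = ν ∧ ∑ μ, dirUv (fine n M) Rc lam μ ≤ Λ * (n : ℝ) ^ d / (n : ℝ) ^ 2 * ∑ z, ‖ν z‖ ^ 2 := by
  have hn : (0 : ℝ) < (n : ℝ) := by exact_mod_cast Nat.pos_of_ne_zero (NeZero.ne n)
  obtain ⟨f, hf, hb⟩ := hUBc ν
  refine ⟨f, hf, ?_⟩
  rw [Scv_eq, nsqv_eq_sum] at hb
  have hnd : (0 : ℝ) < (n : ℝ) ^ d := by positivity
  have hn2 : (0 : ℝ) < (n : ℝ) ^ 2 := by positivity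
  rw [div_mul_eq_mul_div, div_le_iff₀ hnd] at hb
  rw [div_mul_eq_mul_div, le_div_iff₀ hn2]
  linarith

/-- **REG⁺-colour (Laplacian form) in physical units**: at a constrained minimiser `ρ_Lap f ≤ Λ·Scv f`. [folklore] -/
theorem rhoLapv_le_of_isMin {Rc : Tor (fine n M) → Fin d → (E →L[ℂ] E)} {T : Tor (fine n M) → (E →L[ℂ] E)}
    (hT : ∀ x, T x ∈ unitary (E →L[ℂ] E)) {Λ : ℝ} (hΛ : 0 ≤ Λ)
    (hUBc : ∀ μ : Tor M → E, ∃ f, Qkv n M T f = μ ∧ Scv n M Rc f ≤ Λ * nsqv μ)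
    {μ : Tor M → E} {f : Tor (fine n M) → E} (hf : Qkv n M T f = μ) (hmin : ∀ g, Qkv n M T g = μ → Scv n M Rc f ≤ Scv n M Rc g) :
    rhoLapv n M Rc f ≤ Λ * Scv n M Rc f := by
  have hn : (0 : ℝ) < (n : ℝ) := by exact_mod_cast Nat.pos_of_ne_zero (NeZero.ne n)
  have hnd : (0 : ℝ) < (n : ℝ) ^ d := by positivity
  have hn2 : (0 : ℝ) < (n : ℝ) ^ 2 := by positivity
  have hmin' : ∀ g, Qcv n M T g = μ → ∑ ν, dirUv (fine n M) Rc f ν ≤ ∑ ν, dirUv (fine n M) Rc g ν := by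
    intro g hg
    have h := hmin g hg
    rw [Scv_eq, Scv_eq] at h
    exact le_of_mul_le_mul_left h (by positivity)
  have h := nsqv_negLapv_le_of_isMin n M hT Rc (Λ := Λ * (n : ℝ) ^ d / (n : ℝ) ^ 2) (by positivity) (hUB_lat n M hUBc) hf hmin'
  unfold rhoLapv
  rw [Scv_eq]
  calc (n : ℝ) ^ 4 / (n : ℝ) ^ d * VariationalColourBochner.nsqv (fine n M) (negLapv (fine n M) Rc f)
      ≤ (n : ℝ) ^ 4 / (n : ℝ) ^ d * (Λ * (n : ℝ) ^ d / (n : ℝ) ^ 2 / (n : ℝ) ^ d * ∑ ν, dirUv (fine n M) Rc f ν) :=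
        mul_le_mul_of_nonneg_left h (by positivity)
    _ = Λ * ((n : ℝ) ^ 2 / (n : ℝ) ^ d * ∑ ν, dirUv (fine n M) Rc f ν) := by field_simp

/-! ## §3 Bochner in physical units and the `hREG` binder for `rhov` -/

/-- **Bochner in physical units** (every `f`; UNITARY bond operators with plaquette defect `≤ a` in operator norm):
`rhov f ≤ 2·ρ_Lap f + 2d·(a n²)·Scv f + d²·(a n²)²·qWv f`. [folklore] -/
theorem rhov_le {Rc : Tor (fine n M) → Fin d → (E →L[ℂ] E)} (hRc : ∀ x μ, Rc x μ ∈ unitary (E →L[ℂ] E)) {a : ℝ} (ha : 0 ≤ a)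
    (hP : ∀ x μ ν, ‖Rc x μ * Rc (x + unitVec (fine n M) μ) ν - Rc x ν * Rc (x + unitVec (fine n M) ν) μ‖ ≤ a)
    (f : Tor (fine n M) → E) :
    rhov n M Rc f ≤ 2 * rhoLapv n M Rc f + 2 * d * (a * (n : ℝ) ^ 2) * Scv n M Rc f + (d : ℝ) ^ 2 * (a * (n : ℝ) ^ 2) ^ 2 * qWv n M f := by
  have hn : (0 : ℝ) < (n : ℝ) := by exact_mod_cast Nat.pos_of_ne_zero (NeZero.ne n)
  have hnd : (n : ℝ) ^ d ≠ 0 := by positivity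
  have h := hessian_le (fine n M) hRc ha hP f
  rw [sum_nsqv_Dirv_eq, ← hessv_eq_sum_nsqv] at h
  have hrho : rhov n M Rc f = (n : ℝ) ^ 4 / (n : ℝ) ^ d * hessv (fine n M) Rc f := rfl
  have hqW : qWv n M f = ((n : ℝ) ^ d)⁻¹ * VariationalColourBochner.nsqv (fine n M) f := rfl
  unfold rhoLapv
  rw [hrho, hqW, Scv_eq]
  have h2 := mul_le_mul_of_nonneg_left h (show (0 : ℝ) ≤ (n : ℝ) ^ 4 / (n : ℝ) ^ d by positivity)
  refine h2.trans (le_of_eq ?_)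
  field_simp

/-- **`hREG` LITERAL for `ρ = rhov`** — the binder of `VariationalColourScalarPair.colour_pair_bracket` ∕ `VariationalCovariantAssemblySqrt.
pair_bracket_sqrt` at `ρ := rhov n M Rc`, `C_R := 2Λ + 2d·(a n²) + d²·(a n²)²·C_P`, under the DATA binders UNITARY `T`, UNITARY `Rc` with
plaquette defect `≤ a`, the UB⁺ binder `hUBc` and the P⁺ binder `hPc` (both in the colour letters, supplied by the sibling leaves). [folklore] -/
theorem hREG_rhov {Rc : Tor (fine n M) → Fin d → (E →L[ℂ] E)} {T : Tor (fine n M) → (E →L[ℂ] E)}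
    (hT : ∀ x, T x ∈ unitary (E →L[ℂ] E)) (hRc : ∀ x μ, Rc x μ ∈ unitary (E →L[ℂ] E)) {a : ℝ} (ha : 0 ≤ a)
    (hP : ∀ x μ ν, ‖Rc x μ * Rc (x + unitVec (fine n M) μ) ν - Rc x ν * Rc (x + unitVec (fine n M) ν) μ‖ ≤ a)
    {Λ CP : ℝ} (hΛ : 0 ≤ Λ)
    (hUBc : ∀ μ : Tor M → E, ∃ f, Qkv n M T f = μ ∧ Scv n M Rc f ≤ Λ * nsqv μ)
    (hPc : ∀ f, qWv n M f ≤ CP * (Scv n M Rc f + nsqv (Qkv n M T f))) :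
    ∀ (μ : Tor M → E) (f : Tor (fine n M) → E), Qkv n M T f = μ → (∀ g, Qkv n M T g = μ → Scv n M Rc f ≤ Scv n M Rc g) →
      rhov n M Rc f ≤ (2 * Λ + 2 * d * (a * (n : ℝ) ^ 2) + (d : ℝ) ^ 2 * (a * (n : ℝ) ^ 2) ^ 2 * CP) * (Scv n M Rc f + nsqv μ) := by
  intro μ f hf hmin
  have h1 := rhov_le n M hRc ha hP f
  have h2 := rhoLapv_le_of_isMin n M hT hΛ hUBc hf hmin
  have h3 : qWv n M f ≤ CP * (Scv n M Rc f + nsqv μ) := by rw [← hf]; exact hPc f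
  have hZ0 : 0 ≤ nsqv μ := nsqv_nonneg μ
  have hα : 0 ≤ a * (n : ℝ) ^ 2 := by positivity
  have hd : (0 : ℝ) ≤ d := Nat.cast_nonneg d
  set α : ℝ := a * (n : ℝ) ^ 2 with hαdef
  set S : ℝ := Scv n M Rc f
  set Z : ℝ := nsqv μ
  have e1 : (d : ℝ) ^ 2 * α ^ 2 * qWv n M f ≤ (d : ℝ) ^ 2 * α ^ 2 * (CP * (S + Z)) := mul_le_mul_of_nonneg_left h3 (by positivity)
  have p1 : 0 ≤ Λ * Z := mul_nonneg hΛ hZ0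
  have p2 : 0 ≤ (d : ℝ) * α * Z := mul_nonneg (mul_nonneg hd hα) hZ0
  have key : (2 * Λ + 2 * d * α + (d : ℝ) ^ 2 * α ^ 2 * CP) * (S + Z)
      = 2 * (Λ * S) + 2 * d * α * S + (d : ℝ) ^ 2 * α ^ 2 * (CP * (S + Z)) + (2 * (Λ * Z) + 2 * ((d : ℝ) * α * Z)) := by ring
  rw [key]
  linarith

end Summit.QuantumFields.BalabanUV.T4Continuum.VariationalColourRegularityRho

end
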